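import Summits.QuantumFields.QCD.Theorems.HeatSlicedQuarksRobustYangMillsHandoverStubMassDerivativeOfUpdate
import Summits.QuantumFields.QCD.Theorems.HeatSlicedQuarksRobustYangMillsHandoverStubFermiBoltzmannUpdate
import HarnessLib

/-!
# Stub `stub_connectedCorr_massDerivative` of line `pin-the-infimum`
(crux `Summit.QuantumFields.QCD.Theses.HeatSlicedQuarks.RobustYangMillsHandover`,
item stmt-QuantumFields-8892; first lemma of the pseudomass / sigma-term engine)

**Feynman–Hellmann for the connected Euclidean-time correlator along the flavour-diagonal mass
direction.**  On the four-torus of side `2S+1`, for gauge-invariant local observables `A, B` and the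
common shift `m ↦ m + t(1,…,1)` of the bare quark masses,

`d/dt|₀ (⟨A(0)B(ne₀)⟩ − ⟨A⟩⟨B⟩) = −(⟨ABΣ⟩ − ⟨AB⟩⟨Σ⟩) + (⟨AΣ⟩ − ⟨A⟩⟨Σ⟩)⟨B⟩ + ⟨A⟩(⟨BΣ⟩ − ⟨B⟩⟨Σ⟩)`,

`Σ = Σ_f Σ_{x,a,α} ψ̄_{f,x,a,α} ψ_{f,x,a,α}` the total scalar density (minus the truncated three-point
function), whenever the fermionic partition function does not vanish.

Proof.  (1) The `N_f`-flavour Wilson–Dirac matrix is affine along the diagonal with slope the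
identity, `D(U, m + t) = D(U, m) + t·1` (`wilsonDirac_apply_mass_shift`), so by
`grassmannExp_quadratic_add` the Boltzmann factor splits as `e^{−ψ̄D(m+t)ψ} = e^{−ψ̄D(m)ψ} exp(−tΣ)`
with `Σ = ψ̄1ψ` central and nilpotent.  (2) The abstract engine
`hasDerivAt_integral_fermiIntegral_mul_grassmannExp` (derivative of the un-normalised functional in
the coefficient of a nilpotent central insertion) and the quotient rule give
`d/dt|₀ ⟨Y⟩_{m+t} = −(⟨YΣ⟩ − ⟨Y⟩⟨Σ⟩)` for every coefficient-regular insertion `Y`, in particular for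
`A(0)`, `B(ne₀)` and their product.  (3) The product rule on `⟨AB⟩ − ⟨A⟩⟨B⟩`.  Glimm–Jaffe,
*Quantum Physics* §17.5 (differentiate the defining identity in `σ`); Montvay–Münster §4.1.
Everything is proved; no named fact. [folklore]
-/

noncomputable section

open MeasureTheory Filter Function Matrix
open Literature.MathematicalPhysics.QuantumFieldTheory Literature.MathematicalPhysics.QuantumLattice
open Literature.Probability.LatticeModels
open Literature.MathematicalPhysics.QuantumLattice.GrassmannAlgebra

namespace Summit.QuantumFields.QCD.Cruxes.RobustYangMillsHandover.PinTheInfimum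

namespace StubConnectedCorrMassDerivative

open StubMassDerivativeOfUpdate StubFermiBoltzmannUpdate

variable {Nf S : ℕ} [NeZero S]

/-- **The `N_f`-flavour Dirac matrix is affine along the flavour diagonal with slope the identity**:
`D(U, m + t(1,…,1)) = D(U, m) + t·1`. [folklore] -/
theorem diracMatrix_add_const (U : GaugeConfig 4 S (Matrix.specialUnitaryGroup (Fin 3) ℂ))
    (mq : Fin Nf → ℝ) (t : ℝ) :
    diracMatrix U (fun f => mq f + t) =
      diracMatrix U mq + ((t : ℝ) : ℂ) • (1 : Matrix (FermiIdx Nf S) (FermiIdx Nf S) ℂ) := by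
  ext i j
  obtain ⟨⟨f₁, p⟩, rfl⟩ := quarkEquiv.surjective i
  obtain ⟨⟨f₂, p'⟩, rfl⟩ := quarkEquiv.surjective j
  simp only [diracMatrix, Matrix.reindex_apply, Matrix.submatrix_apply, Matrix.of_apply,
    Equiv.symm_apply_apply, Matrix.add_apply, Matrix.smul_apply, Matrix.one_apply,
    EmbeddingLike.apply_eq_iff_eq, Prod.mk.injEq, smul_eq_mul]
  by_cases hf : f₁ = f₂
  · subst hf
    rw [wilsonDirac_apply_mass_shift (fundamentalRep (Fin 3)) U (mq f₁) (mq f₁ + t) 1 p p',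
      add_sub_cancel_left]
    by_cases hp : p = p'
    · subst hp
      simp
    · simp [hp]
  · simp [hf]

/-- **The total scalar density as a quadratic action**:
`ψ̄1ψ = Σ_f Σ_{x,a,α} ψ̄_{f,x,a,α} ψ_{f,x,a,α}`. [folklore] -/
theorem quadratic_one_eq_scalarDensity :
    quadratic ℂ (1 : Matrix (FermiIdx Nf S) (FermiIdx Nf S) ℂ) =
      ∑ f : Fin Nf, ∑ x : TorusSite 4 S, ∑ a : Fin 3, ∑ α : Fin 4,
        qbar (f, (x, a, α)) * q (f, (x, a, α)) := by
  have h1 : quadratic ℂ (1 : Matrix (FermiIdx Nf S) (FermiIdx Nf S) ℂ) =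
      ∑ i : FermiIdx Nf S, psiBar ℂ i * psi ℂ i := by
    unfold quadratic
    refine Finset.sum_congr rfl fun i _ => ?_
    rw [Finset.sum_eq_single i]
    · rw [Matrix.one_apply_eq, one_smul]
    · intro j _ hj
      rw [Matrix.one_apply_ne (Ne.symm hj), zero_smul]
    · intro h
      exact absurd (Finset.mem_univ i) h
  rw [h1, ← Equiv.sum_comp quarkEquiv]
  simp only [Fintype.sum_prod_type]
  rfl

/-- **The diagonal mass shift of the fermionic Boltzmann factor splits off the total scalar density**:
`e^{−ψ̄D(U, m + t)ψ} = e^{−ψ̄D(U, m)ψ} · exp(−t Σ_f Σ_{x,a,α} ψ̄_{f,x,a,α}ψ_{f,x,a,α})`. [folklore] -/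
theorem fermiBoltzmann_add_const (U : GaugeConfig 4 S (Matrix.specialUnitaryGroup (Fin 3) ℂ))
    (mq : Fin Nf → ℝ) (t : ℝ) :
    fermiBoltzmann U (fun f => mq f + t) =
      fermiBoltzmann U mq *
        grassmannExp (-(((t : ℝ) : ℂ) •
          ∑ f : Fin Nf, ∑ x : TorusSite 4 S, ∑ a : Fin 3, ∑ α : Fin 4,
            qbar (f, (x, a, α)) * q (f, (x, a, α)))) := by
  rw [fermiBoltzmann, fermiBoltzmann, diracMatrix_add_const U mq t, neg_add,
    grassmannExp_quadratic_add, ← neg_smul, quadratic_smul, quadratic_one_eq_scalarDensity, neg_smul]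

/-- **Feynman–Hellmann along the flavour diagonal for an abstract coefficient-regular insertion**:
`t ↦ ⟨X⟩_{β,S,m+t(1,…,1)}` has derivative `−(⟨XΣ⟩ − ⟨X⟩⟨Σ⟩)` at `t = 0`, `Σ` the total scalar
density, whenever the fermionic partition function is non-zero (engine
`hasDerivAt_integral_fermiIntegral_mul_grassmannExp` + quotient rule + centrality of `Σ`). [folklore] -/
theorem hasDerivAt_qcdTorusExpect_add_const (β : ℝ) (mq : Fin Nf → ℝ)
    {X : GaugeConfig 4 S (Matrix.specialUnitaryGroup (Fin 3) ℂ) → FermiAlg Nf S} (hX : CoeffRegular X)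
    (hZ : (∫ U, fermiIntegral (fermiBoltzmann U mq)
      ∂(wilsonMeasure (d := 4) (L := S) (fundamentalRep (Fin 3)) β)) ≠ 0) :
    HasDerivAt (fun t : ℝ => qcdTorusExpect β S (fun f => mq f + t) X)
      (-(qcdTorusExpect β S mq (fun U => X U *
            ∑ f : Fin Nf, ∑ x : TorusSite 4 S, ∑ a : Fin 3, ∑ α : Fin 4,
              qbar (f, (x, a, α)) * q (f, (x, a, α))) -
        qcdTorusExpect β S mq X * qcdTorusExpect β S mq (fun _ =>
            ∑ f : Fin Nf, ∑ x : TorusSite 4 S, ∑ a : Fin 3, ∑ α : Fin 4,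
              qbar (f, (x, a, α)) * q (f, (x, a, α))))) 0 := by
  set σ : FermiAlg Nf S := ∑ f : Fin Nf, ∑ x : TorusSite 4 S, ∑ a : Fin 3, ∑ α : Fin 4,
    qbar (f, (x, a, α)) * q (f, (x, a, α)) with hσ
  have hquad : quadratic ℂ (1 : Matrix (FermiIdx Nf S) (FermiIdx Nf S) ℂ) = σ :=
    quadratic_one_eq_scalarDensity
  have hnil : IsNilpotent σ := hquad ▸ isNilpotent_quadratic ℂ _
  have hcomm : ∀ z, Commute σ z := fun z => hquad ▸ commute_quadratic ℂ _ z
  have hupd : ∀ (U : GaugeConfig 4 S (Matrix.specialUnitaryGroup (Fin 3) ℂ)) (μ : ℝ),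
      fermiBoltzmann U (fun f => mq f + μ) =
        fermiBoltzmann U mq * grassmannExp (-(((μ - 0 : ℝ) : ℂ) • σ)) := fun U μ => by
    rw [sub_zero]
    exact fermiBoltzmann_add_const U mq μ
  have hB := coeffRegular_fermiBoltzmann (S := S) mq
  have hN : HasDerivAt (fun μ : ℝ => ∫ U, fermiIntegral (X U * fermiBoltzmann U (fun f => mq f + μ))
        ∂(wilsonMeasure (d := 4) (L := S) (fundamentalRep (Fin 3)) β))
      (-(∫ U, fermiIntegral (X U * fermiBoltzmann U mq * σ)
        ∂(wilsonMeasure (d := 4) (L := S) (fundamentalRep (Fin 3)) β))) 0 := by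
    refine (hasDerivAt_integral_fermiIntegral_mul_grassmannExp _ (hX.mul hB) hnil 0).congr_of_eventuallyEq
      (Eventually.of_forall fun μ => ?_)
    simp only [hupd, mul_assoc]
  have hD : HasDerivAt (fun μ : ℝ => ∫ U, fermiIntegral (fermiBoltzmann U (fun f => mq f + μ))
        ∂(wilsonMeasure (d := 4) (L := S) (fundamentalRep (Fin 3)) β))
      (-(∫ U, fermiIntegral (fermiBoltzmann U mq * σ)
        ∂(wilsonMeasure (d := 4) (L := S) (fundamentalRep (Fin 3)) β))) 0 := by
    refine (hasDerivAt_integral_fermiIntegral_mul_grassmannExp _ hB hnil 0).congr_of_eventuallyEq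
      (Eventually.of_forall fun μ => ?_)
    simp only [hupd]
  have hD0 : (∫ U, fermiIntegral (fermiBoltzmann U (fun f => mq f + (0 : ℝ)))
      ∂(wilsonMeasure (d := 4) (L := S) (fundamentalRep (Fin 3)) β)) ≠ 0 := by
    simpa only [add_zero] using hZ
  have e1 : ∀ U : GaugeConfig 4 S (Matrix.specialUnitaryGroup (Fin 3) ℂ),
      X U * σ * fermiBoltzmann U mq = X U * fermiBoltzmann U mq * σ := fun U => by
    rw [mul_assoc, (hcomm _).eq, ← mul_assoc]
  have e2 : ∀ U : GaugeConfig 4 S (Matrix.specialUnitaryGroup (Fin 3) ℂ),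
      σ * fermiBoltzmann U mq = fermiBoltzmann U mq * σ := fun U => (hcomm _).eq
  unfold qcdTorusExpect
  refine (hN.div hD hD0).congr_deriv ?_
  simp only [add_zero, e1, e2]
  field_simp
  ring

end StubConnectedCorrMassDerivative

open StubMassDerivativeOfUpdate StubConnectedCorrMassDerivative in
/-- T4: Feynman–Hellmann for the connected Euclidean-time correlator along the flavour-diagonal mass direction. -/
theorem stub_connectedCorr_massDerivative :
    ∀ (Nf : ℕ) (β : ℝ) (S : ℕ) (mq : Fin Nf → ℝ) (R R' : ℕ) (A : QCDLatticeObservable Nf R)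
      (B : QCDLatticeObservable Nf R') (n : ℕ),
      (∫ U, fermiIntegral (fermiBoltzmann U mq)
          ∂(wilsonMeasure (d := 4) (L := 2 * S + 1) (fundamentalRep (Fin 3)) β)) ≠ 0 →
      HasDerivAt (fun t : ℝ => qcdLatticeConnectedCorr β (2 * S + 1) (fun f => mq f + t) A B n)
        (-(qcdTorusExpect β (2 * S + 1) mq (fun U => A.onTorus (2 * S + 1) 0 U *
              B.onTorus (2 * S + 1) (Pi.single 0 (n : ℤ)) U *
                ∑ f : Fin Nf, ∑ x : TorusSite 4 (2 * S + 1), ∑ a : Fin 3, ∑ α : Fin 4,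
                  qbar (f, (x, a, α)) * q (f, (x, a, α))) -
            qcdTorusExpect β (2 * S + 1) mq (fun U => A.onTorus (2 * S + 1) 0 U *
              B.onTorus (2 * S + 1) (Pi.single 0 (n : ℤ)) U) *
            qcdTorusExpect β (2 * S + 1) mq (fun _ =>
                ∑ f : Fin Nf, ∑ x : TorusSite 4 (2 * S + 1), ∑ a : Fin 3, ∑ α : Fin 4,
                  qbar (f, (x, a, α)) * q (f, (x, a, α)))) +
          (qcdTorusExpect β (2 * S + 1) mq (fun U => A.onTorus (2 * S + 1) 0 U *
                ∑ f : Fin Nf, ∑ x : TorusSite 4 (2 * S + 1), ∑ a : Fin 3, ∑ α : Fin 4,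
                  qbar (f, (x, a, α)) * q (f, (x, a, α))) -
            qcdTorusExpect β (2 * S + 1) mq (A.onTorus (2 * S + 1) 0) *
            qcdTorusExpect β (2 * S + 1) mq (fun _ =>
                ∑ f : Fin Nf, ∑ x : TorusSite 4 (2 * S + 1), ∑ a : Fin 3, ∑ α : Fin 4,
                  qbar (f, (x, a, α)) * q (f, (x, a, α)))) *
            qcdTorusExpect β (2 * S + 1) mq (B.onTorus (2 * S + 1) (Pi.single 0 (n : ℤ))) +
          qcdTorusExpect β (2 * S + 1) mq (A.onTorus (2 * S + 1) 0) *
            (qcdTorusExpect β (2 * S + 1) mq (fun U => B.onTorus (2 * S + 1) (Pi.single 0 (n : ℤ)) U *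
                ∑ f : Fin Nf, ∑ x : TorusSite 4 (2 * S + 1), ∑ a : Fin 3, ∑ α : Fin 4,
                  qbar (f, (x, a, α)) * q (f, (x, a, α))) -
              qcdTorusExpect β (2 * S + 1) mq (B.onTorus (2 * S + 1) (Pi.single 0 (n : ℤ))) *
              qcdTorusExpect β (2 * S + 1) mq (fun _ =>
                ∑ f : Fin Nf, ∑ x : TorusSite 4 (2 * S + 1), ∑ a : Fin 3, ∑ α : Fin 4,
                  qbar (f, (x, a, α)) * q (f, (x, a, α)))))
        0 := by
  intro Nf β S mq R R' A B n hZ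
  have hAB := hasDerivAt_qcdTorusExpect_add_const β mq
    ((coeffRegular_onTorus (S := 2 * S + 1) A 0).mul
      (coeffRegular_onTorus (S := 2 * S + 1) B (Pi.single 0 (n : ℤ)))) hZ
  have hA := hasDerivAt_qcdTorusExpect_add_const β mq (coeffRegular_onTorus (S := 2 * S + 1) A 0) hZ
  have hB := hasDerivAt_qcdTorusExpect_add_const β mq
    (coeffRegular_onTorus (S := 2 * S + 1) B (Pi.single 0 (n : ℤ))) hZ
  unfold qcdLatticeConnectedCorr
  refine (hAB.sub (hA.mul hB)).congr_deriv ?_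
  simp only [add_zero]
  ring

end Summit.QuantumFields.QCD.Cruxes.RobustYangMillsHandover.PinTheInfimum

end
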